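import Summits.BirchSwinnertonDyer.BirchSwinnertonDyer.Theorems.EisensteinPrimesMazurMCOnCellBTypeAPeriodLadder
import Summits.BirchSwinnertonDyer.BirchSwinnertonDyer.Theorems.EisensteinPrimesMazurMCOnCellBLocate
import Summits.BirchSwinnertonDyer.Rank1Residual.X2.AnalyticInvariants
import Summits.BirchSwinnertonDyer.Rank1Residual.X2.IsogenyClassStability
import HarnessLib

/-!
# Crux `MazurMCOnCellB` (stmt-BirchSwinnertonDyer-19033), line `mudescent`, stub
# `stub_analyticMuZero_offLocus` — helper 4: the off-locus member MINIMISES the analytic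
# `μ`-invariant in its isogeny class; the stub is EQUIVALENT to the class-wide expectation
# «some member has `μ_an = 0`» (cell `bsd-eis`, seat `bsd-eis-mu-a`, PART 1b seat (1))

WHY (seat brief: ACCEL-LIST (1) + CORRECTION l.840 — «CONSTRUCTION seat, open-problem grade … report
honestly if the census exhausts without a theorem (typed obstruction = result)»). The registered stub
`stub_analyticMuZero_offLocus : ∀ W₀ p, X2.CellB W₀ p → ¬ HasRamifiedOddLineAt W₀ p → X2.AnalyticMuLE W₀ p 0`
asks: for the OFF-LOCUS member `W₀` of a type-A multiplicative Eisenstein class (every rational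
`p`-line unramified-even; the «étale end», Stevens' `A_min` at `p`), the Mazur–Tate–Teitelbaum
`p`-adic `L`-function normalised by `Ω(W₀)` has a unit coefficient. This file proves, from the
type-A period ladder (helper 3, `…TypeAPeriodLadder`: `Ω(W₀) = u · p^j · Ω(W)` for every `W ∼ W₀`,
`|u|_p = 1`, `j ≥ 0`):

* §1 `analyticMuLE_of_isIsogenous_etaleEnd` — **`μ_an` is MINIMAL at the étale end**: for every
  member `W` of the class and every `m`, `X2.AnalyticMuLE W p m → X2.AnalyticMuLE W₀ p m`
  (the data `f`, `L` of `AnalyticMuLE` are class invariants — `IsNewformOf.of_isIsogenous`,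
  `X2.IsogenyQuotientLine.hasSplitMultiplicativeReductionAtPrime_iff_of_isIsogenous` — and
  `ϖ₀ = ϖ · (u p^j)⁻¹` has `‖ϖ₀‖_p = p^j ‖ϖ‖_p ≥ ‖ϖ‖_p`);
* §2 `analyticMuLE_zero_offLocus_of_isIsogenous` — the stub's hypotheses verbatim
  (`X2.CellB W₀ p`, `¬ HasRamifiedOddLineAt W₀ p`) plus ONE member `W ∼ W₀` with
  `X2.AnalyticMuLE W p 0` give the stub's conclusion `X2.AnalyticMuLE W₀ p 0`;
* §3 `stub_analyticMuZero_offLocus_iff_exists_member` — **the stub is EQUIVALENT to the class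
  statement** `∀ W p, X2.CellB W p → ∃ W' ∼ W, X2.AnalyticMuLE W' p 0` («in every X2b isogeny class
  SOME member has analytic `μ = 0`»), using the LANDED `stub_locate` (p443911) for «⇒».

TYPED OBSTRUCTION (the seat's honest report). §3 says the off-locus hypothesis of the stub buys
EXACTLY the choice of the best member and nothing more: the stub is, verbatim, the analytic face of
Greenberg's `μ`-conjecture for X2b classes — Stevens, Invent. Math. 98 (1989) Rem. 4.14 «It would be
surprising if the μ-invariants for `A_min` were ever positive … we expect that the above inequality
is actually an equality»; Greenberg–Vatsal 2000, Remark after Cor. (3.8) «one could even conjecture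
in general that the μ-invariant vanishes for the optimal curve in an isogeny class»; Greenberg LNM
1716 Conj. 1.11. No printed theorem asserts it on a `¬ GVPar` row (cell literature check, bsd-eis
STATUS 2026-08-26 13:21:09Z: Stevens §4 is good-ordinary and (4.12)–(4.13) is a conditional LOWER
bound; GV Thm. (1.3)'s hypothesis is `GVPar`; GV (3.11)/(3.12) control the twists of parity
`−ψ(−1)`, i.e. the ODD branch on type A; Bellaïche–Pollack 2019 / Pollack–Wake 2025 are tame level
`1` / prime level `p ∤ N`). Per pair it is the cell's two-engine certificate on ANY member
(§1 transports it to `W₀`). HONEST FRAMING: kernel theorems only (no definition, no named fact, no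
`sorry`); the stub and the crux stay OPEN. References: [Stevens1989] Thm. 2.3, Cor. 4.13, Rem. 4.14;
[GreenbergVatsal2000] §3 Cor. (3.8), Rem. (3.9), p. 5; [GreenbergLNM1716] Conj. 1.11, Prop. 5.7, §5;
[DokchitserLocalInvariants2015] Thm. 2; [MazurTateTeitelbaum1986] §I.14; HOME/ky-g7/Lines-mudescent.md.
-/

set_option autoImplicit false

noncomputable section

open scoped Classical NumberField MatrixGroups ModularForm

open PowerSeries WeierstrassCurve CongruenceSubgroup Field IsDedekindDomain NumberField
  Literature.NumberTheory.EllipticCurves Literature.NumberTheory.EllipticCurves.Rank1Residual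
  Literature.NumberTheory.EllipticCurves.ModularForms Literature.NumberTheory.GaloisRepresentations
  Literature.Barriers.BirchSwinnertonDyer
  Summit.BirchSwinnertonDyer.Rank1Residual Summit.BirchSwinnertonDyer.Rank1Residual.GVPeriod
  Summit.BirchSwinnertonDyer.BirchSwinnertonDyer.Theorems.EisensteinPrimesMazurMCOnCellBTypeAPeriodLadder

-- `Summit.BirchSwinnertonDyer.BirchSwinnertonDyer.…`: the summit and its single sub-problem share a name (D-0017 layout).
set_option linter.dupNamespace false

namespace Summit.BirchSwinnertonDyer.BirchSwinnertonDyer.Theorems.EisensteinPrimesMazurMCOnCellBAnalyticMuOffLocus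

variable {W W₀ : WeierstrassCurve ℚ} [W.IsElliptic] [W₀.IsElliptic] [W.IsGloballyMinimal]
  [W₀.IsGloballyMinimal] {p : ℕ} [hp : Fact p.Prime]

/-! ## §1. The analytic `μ`-invariant is minimal at the étale end -/

/-- **`μ_an` is minimal at the étale end of a type-A class.** Let `W`, `W₀` be `ℚ`-isogenous globally
minimal elliptic curves, `p` odd of good ordinary or multiplicative reduction for `W`, `W` of type A
(`¬ GVPar W p`), and every rational `p`-line of `W₀` unramified. Then for every `m`,
`X2.AnalyticMuLE W p m → X2.AnalyticMuLE W₀ p m`: «`μ_an(W₀) ≤ μ_an(W)`». Given the data `f`, `ϖ₀`,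
`L` of `AnalyticMuLE W₀ p m` (newform, Néron normalisation `ϖ₀ Ω(W₀) = Ω⁺_f`, THE Mazur–Tate–
Teitelbaum `p`-adic `L`-function at the multiplicative prime), the ladder (helper 3) gives
`Ω(W₀) = u p^j Ω(W)`, so `ϖ := ϖ₀ u p^j` is a Néron normalisation for `W` with the SAME `f`, `L`
(class invariants), and `‖ϖ · L_k‖ = p^{-j} ‖ϖ₀ · L_k‖ ≤ ‖ϖ₀ · L_k‖`.
[cite: Stevens1989, Thm. 2.3 and Rem. 4.14] [cite: GreenbergVatsal2000, §3, Remark after Cor. (3.8) (p. 40)] -/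
theorem analyticMuLE_of_isIsogenous_etaleEnd (hp2 : p ≠ 2)
    (hred : (W.HasGoodReductionAtPrime p ∧ ¬ (p : ℤ) ∣ W.frobeniusTrace p) ∨
      W.HasMultiplicativeReductionAtPrime p)
    (hnpar : ¬ GVPar W p)
    (hW₀ : ∀ Φ : AddSubgroup (geomTorsion W₀ (p : ℤ)), IsRationalLine W₀ p Φ → LineUnramifiedAt W₀ p Φ)
    (hiso : IsIsogenous W W₀) (m : ℕ) (hμ : X2.AnalyticMuLE W p m) : X2.AnalyticMuLE W₀ p m := by
  intro N _ f hf₀ ϖ₀ hϖ₀ L hLs hLn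
  -- the same newform and `p`-adic `L`-function for `W`
  have hf : IsNewformOf W f := hf₀.of_isIsogenous hiso
  have hsplit : W.HasSplitMultiplicativeReductionAtPrime p ↔ W₀.HasSplitMultiplicativeReductionAtPrime p :=
    X2.IsogenyQuotientLine.hasSplitMultiplicativeReductionAtPrime_iff_of_isIsogenous hiso
  -- the ladder
  obtain ⟨u, j, hu, hΩ⟩ := exists_unit_pow_of_isIsogenous_etaleEnd hp2 hred hnpar hf hW₀ hiso
  -- the Néron normalisation of `W`
  set ϖ : ℚ := ϖ₀ * (u * (p : ℚ) ^ j) with hϖdef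
  have hϖ : (ϖ : ℝ) * W.realPeriodRat = plusPeriod f := by
    rw [← hϖ₀, hΩ, hϖdef]; push_cast; ring
  obtain ⟨k, hk⟩ := hμ f hf ϖ hϖ L (fun hs ↦ hLs (hsplit.mp hs)) (fun hns ↦ hLn (fun hs ↦ hns (hsplit.mpr hs)))
  refine ⟨k, lt_of_lt_of_le hk ?_⟩
  -- `‖ϖ L_k‖ = ‖ϖ₀‖ · ‖u‖ · ‖p‖^j · ‖L_k‖ ≤ ‖ϖ₀ L_k‖`
  have hcast : ((ϖ : ℚ) : ℚ_[p]) = ((ϖ₀ : ℚ) : ℚ_[p]) * (((u : ℚ) : ℚ_[p]) * (p : ℚ_[p]) ^ j) := by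
    rw [hϖdef]; push_cast; ring
  rw [PowerSeries.coeff_C_mul, PowerSeries.coeff_C_mul, hcast, norm_mul, norm_mul, norm_mul, norm_mul,
    hu, one_mul, norm_pow]
  have hle : ‖(p : ℚ_[p])‖ ^ j ≤ 1 := pow_le_one₀ (norm_nonneg _) (Padic.norm_p_lt_one).le
  calc ‖((ϖ₀ : ℚ) : ℚ_[p])‖ * ‖(p : ℚ_[p])‖ ^ j * ‖PowerSeries.coeff k L‖
      ≤ ‖((ϖ₀ : ℚ) : ℚ_[p])‖ * 1 * ‖PowerSeries.coeff k L‖ := by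
        gcongr
    _ = ‖((ϖ₀ : ℚ) : ℚ_[p])‖ * ‖PowerSeries.coeff k L‖ := by rw [mul_one]

/-! ## §2. The registered stub's hypotheses: `CellB` and off the `μ`-barrier locus -/

omit [W.IsElliptic] [W.IsGloballyMinimal] [W₀.IsElliptic] in
/-- Unpacking `X2.CellB W₀ p` for the ladder: `p ≠ 2`, multiplicative reduction (the `hred`
disjunction), type A. [folklore] -/
theorem hyp_of_cellB (hc : X2.CellB W₀ p) :
    p ≠ 2 ∧ ((W₀.HasGoodReductionAtPrime p ∧ ¬ (p : ℤ) ∣ W₀.frobeniusTrace p) ∨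
      W₀.HasMultiplicativeReductionAtPrime p) ∧ ¬ GVPar W₀ p :=
  ⟨hc.2.1.1, Or.inr hc.2.1.2.2, hc.2.2⟩

/-- **The stub from ONE member.** For `W₀` with `X2.CellB W₀ p` and `¬ HasRamifiedOddLineAt W₀ p`
(VERBATIM the hypotheses of the registered `stub_analyticMuZero_offLocus`) and any `ℚ`-isogenous
globally minimal `W` with `X2.AnalyticMuLE W p m`: `X2.AnalyticMuLE W₀ p m`. In particular the
stub's conclusion `X2.AnalyticMuLE W₀ p 0` follows from «`μ_an = 0`» for ANY member of the class
(e.g. the displayed member of a route-G / route-T per-pair certificate). By §1 with the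
`X2.CellB`-transport of the tree (`X2.cellB_iff_of_isIsogenous`, Tate uniformisation discharged) and
`forall_lineUnramifiedAt_of_not_gvPar_of_not_hasRamifiedOddLineAt` (helper 3).
[cite: GreenbergVatsal2000, §3, Remark after Cor. (3.8) (p. 40)] [cite: Stevens1989, Rem. 4.14] -/
theorem analyticMuLE_offLocus_of_isIsogenous (hc : X2.CellB W₀ p) (hoff : ¬ HasRamifiedOddLineAt W₀ p)
    (hiso : IsIsogenous W W₀) (m : ℕ) (hμ : X2.AnalyticMuLE W p m) : X2.AnalyticMuLE W₀ p m := by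
  obtain ⟨hp2, -, hnpar₀⟩ := hyp_of_cellB hc
  -- (`obtain`, not `have`: a tactic-mode `have` here makes the elaborator consume the implicit
  -- binders hidden in the `def` `X2.AnalyticMuLE` of the goal at the final `exact`)
  obtain ⟨-, hred, hnpar⟩ := hyp_of_cellB
    ((X2.cellB_iff_of_isIsogenous (p := p) TateCurve.Silverman1994_thmV53_tateUniformisation_holds
      TateCurve.Silverman1994_thmV53_corV54_tateUniformisation_holds hiso).mpr hc)
  exact analyticMuLE_of_isIsogenous_etaleEnd hp2 hred hnpar
    (forall_lineUnramifiedAt_of_not_gvPar_of_not_hasRamifiedOddLineAt hnpar₀ hoff) hiso m hμ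

/-! ## §3. The stub is equivalent to «every X2b class has a member with analytic `μ = 0`» -/

/-- **TYPED OBSTRUCTION: `stub_analyticMuZero_offLocus` ⟺ the class-wide analytic `μ = 0`
expectation.** The registered stub (LHS, verbatim its signature) holds iff in every X2b
`ℚ`-isogeny class SOME globally minimal member has `μ_an = 0` w.r.t. its own Néron period (RHS).
«⇒»: by the LANDED `stub_locate` (p443911) every X2b pair is isogenous to an off-locus `W₀`, which
is again X2b (`X2.cellB_iff_of_isIsogenous`). «⇐»: §2. So the off-locus restriction buys exactly the
choice of member: the stub IS Stevens' Rem. 4.14 / Greenberg–Vatsal's Rem. after Cor. (3.8) for the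
X2b classes — no printed theorem, per pair a certificate. [cite: Stevens1989, Cor. 4.13 and Rem. 4.14 (p. 94–95)]
[cite: GreenbergVatsal2000, §3, Remark after Cor. (3.8) (p. 40) and p. 5] [cite: GreenbergLNM1716, Conj. 1.11 (p. 58)] -/
theorem stub_analyticMuZero_offLocus_iff_exists_member :
    (∀ (W₀ : WeierstrassCurve ℚ) [W₀.IsElliptic] [W₀.IsGloballyMinimal] (p : ℕ) [Fact p.Prime],
      X2.CellB W₀ p → ¬ HasRamifiedOddLineAt W₀ p → X2.AnalyticMuLE W₀ p 0) ↔
    (∀ (W : WeierstrassCurve ℚ) [W.IsElliptic] [W.IsGloballyMinimal] (p : ℕ) [Fact p.Prime],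
      X2.CellB W p → ∃ (W' : WeierstrassCurve ℚ) (_ : W'.IsElliptic) (_ : W'.IsGloballyMinimal),
        IsIsogenous W W' ∧ X2.AnalyticMuLE W' p 0) := by
  constructor
  · intro hstub W _ _ p _ hc
    obtain ⟨W₀, hW₀, hW₀', hiso, hoff⟩ :=
      EisensteinPrimesMazurMCOnCellBLocate.stub_locate W p hc
    obtain hc₀ : X2.CellB W₀ p :=
      (X2.cellB_iff_of_isIsogenous (p := p) TateCurve.Silverman1994_thmV53_tateUniformisation_holds
        TateCurve.Silverman1994_thmV53_corV54_tateUniformisation_holds hiso).mp hc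
    exact ⟨W₀, hW₀, hW₀', hiso, hstub W₀ p hc₀ hoff⟩
  · intro hclass W₀ _ _ p _ hc hoff
    obtain ⟨W', hW', hW'', hiso, hμ⟩ := hclass W₀ p hc
    exact analyticMuLE_offLocus_of_isIsogenous hc hoff hiso.symm_of_charZero 0 hμ

end Summit.BirchSwinnertonDyer.BirchSwinnertonDyer.Theorems.EisensteinPrimesMazurMCOnCellBAnalyticMuOffLocus

end
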